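import Literature.AlgebraicGeometry.ModuliOfAbelianVarieties.SiegelPrincipalLevelNormal
import HarnessLib

/-!
# Right translation `[J, aK] ↦ [J, aγK]` on the Siegel Shimura set by an element normalising the level
# ([Deligne1971TravauxShimura] Déf. 3.1, 4.16–4.17; [Milne2005ShimuraVarieties] §5 (5.1), Thm. 13.6)

Topic `AlgebraicGeometry/ModuliOfAbelianVarieties`; namespace `Literature.AlgebraicGeometry.ModuliOfAbelianVarieties`.
THEOREMS ONLY (no definition, no named fact, no instance, no `sorry`; net debt 0).  Cell hodgecm-mathlib, #60 road
(A-p05 g7 table v1, node R60-7 «`HasIntegralHecke`-side bookkeeping»; director g6 RULING s86 (2)(b) banked generic leaf).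

THE PRINT.  [Deligne1971TravauxShimura] Déf. 3.1 p. 136: a model of `M_ℂ(G, h)` «muni de l'action de `G(𝔸_f)`» — the right
translates `[x, a] ↦ [x, ag]`, which for `g` NORMALISING the level `K` preserve the level-`K` quotient
`G(ℚ)∖(X × G(𝔸_f)/K)`; Exemple 4.16 / 4.17 p. 150: for `G = CSp(V)` and `K(N) = {g ∈ CSp(V̂_ℤ) | g ≡ 1 mod N}` the elements of
`CSp(V̂_ℤ) = K(1)` act on `M_{K(N)}` (change of level-`N` structure).  [Milne2005ShimuraVarieties] §5 (5.1) p. 56 (the double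
coset set) and Thm. 13.6 p. 118 (the Hecke action on the canonical model).

WHAT IS HERE (the set-theoretic half of R60-7; the group-theoretic half «`K_δ(1)` normalises `K_δ(N)`» is ★
`principalLevelSubgroup_normal_in_one`, `SiegelPrincipalLevelNormal.lean`).
* §1 (generic level `K ≤ GSp_δ(𝔸_f)`, `γ ∈ N(K)`): `SiegelShimuraSet.mk_mul_eq_mk_mul_of_mem_normalizer` — `[J, aK] = [J′, a′K]`
  implies `[J, aγK] = [J′, a′γK]`; `SiegelShimuraSet.existsUnique_rightTranslate` — there is exactly one self-map `T` of
  `Sh_K(GSp_δ, S^±)(ℂ)` with `T [J, aK] = [J, aγK]` (stated as `∃!`, no `def`).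
* §2 (principal levels): `principalLevelSubgroup_one_le_normalizer : K_δ(1) ≤ N(K_δ(N))` and the specialisations of §1 to
  `γ ∈ K_δ(1)`, `K = K_δ(N)`.
* §3 (the `HasIntegralHecke` reading, ★ `SiegelCanonicalModel` (σ4)-D): for any `Sg : SiegelComplexRecordSystem g δ`, level
  `K : SiegelLevel δ` and `γ ∈ K_δ(1)`, the complex point `(Sg.pts K)⁻¹ [J, aγK]` depends only on the point `(Sg.pts K)⁻¹ [J, aK]`
  — so the point equation that `SiegelRationalModel.HasIntegralHecke` demands of its `ℚ`-endomorphisms `Tq` is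
  REPRESENTATIVE-INDEPENDENT (the predicate is not unsatisfiable for that trivial reason; complements the V-S1 pre-audit,
  director s87 (3), which certified «not too weak»).

## References
* [Deligne1971TravauxShimura] P. Deligne, *Travaux de Shimura*, Sém. Bourbaki 389 (1971): Déf. 3.1 p. 136; Exemple 4.16, 4.17 p. 150.
* [Milne2005ShimuraVarieties] J. S. Milne, *Introduction to Shimura varieties* (2005): §5 (5.1) p. 56, Lemma 5.13 p. 57; Thm. 13.6 p. 118.
-/

set_option autoImplicit false

noncomputable section

open Matrix NumberField IsDedekindDomain

namespace Literature.AlgebraicGeometry.ModuliOfAbelianVarieties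

variable {g : ℕ}

/-! ### §1. Generic level: right translation by an element of the normaliser -/

section Generic

variable {δ : Fin g → ℕ} {K : Subgroup (gspFinAdelic δ)}

/-- **Right translation by `γ ∈ N(K)` respects the double-coset relation**: if `[J, aK] = [J′, a′K]` in
`Sh_K(GSp_δ, S^±)(ℂ) = GSp_δ(ℚ)∖(S^± × GSp_δ(𝔸_f)/K)` then `[J, aγK] = [J′, a′γK]` (the same `q ∈ GSp_δ(ℚ)` witnesses both:
`(aγ)⁻¹ q (a′γ) = γ⁻¹ (a⁻¹ q a′) γ ∈ K` because `γ` normalises `K`). [cite: Deligne1971TravauxShimura, Déf. 3.1 p. 136]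
[cite: Milne2005ShimuraVarieties, §5 (5.1) p. 56] -/
theorem SiegelShimuraSet.mk_mul_eq_mk_mul_of_mem_normalizer {γ : gspFinAdelic δ}
    (hγ : γ ∈ Subgroup.normalizer (K : Set (gspFinAdelic δ)))
    {J J' : C0pm δ} {a a' : gspFinAdelic δ}
    (h : SiegelShimuraSet.mk δ K J a = SiegelShimuraSet.mk δ K J' a') :
    SiegelShimuraSet.mk δ K J (a * γ) = SiegelShimuraSet.mk δ K J' (a' * γ) := by
  rw [SiegelShimuraSet.mk_eq_mk_iff] at h ⊢
  obtain ⟨q, hJ, hq⟩ := h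
  refine ⟨q, hJ, ?_⟩
  -- `hq : q • a'K = aK`, i.e. `(q a')⁻¹ a ∈ K`; conjugating by `γ ∈ N(K)` gives `(q a' γ)⁻¹ (a γ) ∈ K`
  have hq' : (((gspRationalToFinAdelic δ q : gspFinAdelic δ) * a' : gspFinAdelic δ) : gspFinAdelic δ ⧸ K) =
      (a : gspFinAdelic δ ⧸ K) := hq
  have hmem : ((gspRationalToFinAdelic δ q : gspFinAdelic δ) * a')⁻¹ * a ∈ K := QuotientGroup.eq.mp hq'
  have e : ((gspRationalToFinAdelic δ q : gspFinAdelic δ) * (a' * γ))⁻¹ * (a * γ) =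
      γ⁻¹ * (((gspRationalToFinAdelic δ q : gspFinAdelic δ) * a')⁻¹ * a) * γ := by
    simp only [_root_.mul_inv_rev, mul_assoc]
  have hmem' : ((gspRationalToFinAdelic δ q : gspFinAdelic δ) * (a' * γ))⁻¹ * (a * γ) ∈ K := by
    rw [e]; exact ((Subgroup.mem_normalizer_iff''.mp hγ) _).mp hmem
  have hgoal : (((gspRationalToFinAdelic δ q : gspFinAdelic δ) * (a' * γ) : gspFinAdelic δ) : gspFinAdelic δ ⧸ K) =
      ((a * γ : gspFinAdelic δ) : gspFinAdelic δ ⧸ K) := QuotientGroup.eq.mpr hmem'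
  exact hgoal

/-- **The right translate `T_γ : [J, aK] ↦ [J, aγK]` exists and is unique** as a self-map of `Sh_K(GSp_δ, S^±)(ℂ)`, for every
`γ` normalising `K` (existence: descend `(J, a) ↦ [J, aγK]` along the two quotients; uniqueness: every point is a class
`[J, aK]`, ★ `SiegelShimuraSet.mk_surjective`).  Stated as `∃!` — no definition is introduced.
[cite: Deligne1971TravauxShimura, Déf. 3.1 p. 136] [cite: Milne2005ShimuraVarieties, §5 (5.1) p. 56; Thm. 13.6 p. 118] -/
theorem SiegelShimuraSet.existsUnique_rightTranslate {γ : gspFinAdelic δ}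
    (hγ : γ ∈ Subgroup.normalizer (K : Set (gspFinAdelic δ))) :
    ∃! T : SiegelShimuraSet δ K → SiegelShimuraSet δ K,
      ∀ (J : C0pm δ) (a : gspFinAdelic δ), T (SiegelShimuraSet.mk δ K J a) = SiegelShimuraSet.mk δ K J (a * γ) := by
  classical
  -- existence: choose a representative `(J, a)` of each point and translate it
  have hrep : ∀ P : SiegelShimuraSet δ K, ∃ Ja : C0pm δ × gspFinAdelic δ, SiegelShimuraSet.mk δ K Ja.1 Ja.2 = P :=
    fun P => by
      obtain ⟨⟨J, a⟩, h⟩ := SiegelShimuraSet.mk_surjective δ K P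
      exact ⟨(J, a), h⟩
  refine ⟨fun P => SiegelShimuraSet.mk δ K (hrep P).choose.1 ((hrep P).choose.2 * γ), ?_, ?_⟩
  · intro J a
    exact SiegelShimuraSet.mk_mul_eq_mk_mul_of_mem_normalizer hγ (hrep (SiegelShimuraSet.mk δ K J a)).choose_spec
  · intro T hT
    funext P
    obtain ⟨⟨J, a⟩, rfl⟩ := SiegelShimuraSet.mk_surjective δ K P
    change T (SiegelShimuraSet.mk δ K J a) = _
    rw [hT J a]
    exact (SiegelShimuraSet.mk_mul_eq_mk_mul_of_mem_normalizer hγ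
      (hrep (SiegelShimuraSet.mk δ K J a)).choose_spec).symm

/-- Right translation by `γ ∈ N(K)` followed by `γ⁻¹` is the identity on classes (so each `T_γ` is a bijection of
`Sh_K(GSp_δ, S^±)(ℂ)`). [cite: Milne2005ShimuraVarieties, §5 (5.1) p. 56] -/
theorem SiegelShimuraSet.mk_mul_mul_inv {γ : gspFinAdelic δ} (J : C0pm δ) (a : gspFinAdelic δ) :
    SiegelShimuraSet.mk δ K J (a * γ * γ⁻¹) = SiegelShimuraSet.mk δ K J a := by
  rw [mul_inv_cancel_right]

end Generic

/-! ### §2. Principal levels: `K_δ(1) = GSp_δ(ℤ̂)` normalises every `K_δ(N)` -/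

section Principal

variable (δ : Fin g → ℕ)

/-- **`K_δ(1) ≤ N(K_δ(N))`**: every `γ ∈ GSp_δ(ℤ̂)` normalises the principal level `K_δ(N)` (both inclusions of
`k ∈ K_δ(N) ↔ γ k γ⁻¹ ∈ K_δ(N)` from ★ `principalLevelSubgroup_normal_in_one` at `γ` and at `γ⁻¹`).
[cite: Deligne1971TravauxShimura, Exemple 4.16 p. 150] [cite: Milne2005ShimuraVarieties, §6 p. 70] -/
theorem principalLevelSubgroup_one_le_normalizer (N : ℕ) :
    principalLevelSubgroup δ 1 ≤ Subgroup.normalizer (principalLevelSubgroup δ N : Set (gspFinAdelic δ)) := by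
  intro γ hγ
  rw [Subgroup.mem_normalizer_iff]
  intro k
  refine ⟨fun hk => principalLevelSubgroup_normal_in_one δ N hγ hk, fun hk => ?_⟩
  have h := principalLevelSubgroup_normal_in_one δ N ((principalLevelSubgroup δ 1).inv_mem hγ) hk
  have e : γ⁻¹ * (γ * k * γ⁻¹) * γ⁻¹⁻¹ = k := by
    simp only [inv_inv, ← mul_assoc, inv_mul_cancel, one_mul, inv_mul_cancel_right]
  rwa [e] at h

variable {δ}

/-- `[J, aK_δ(N)] = [J′, a′K_δ(N)] ⇒ [J, aγK_δ(N)] = [J′, a′γK_δ(N)]` for `γ ∈ K_δ(1) = GSp_δ(ℤ̂)`.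
[cite: Deligne1971TravauxShimura, Exemple 4.16 and 4.17 p. 150] -/
theorem SiegelShimuraSet.mk_mul_eq_mk_mul_of_mem_principalLevelSubgroup_one {N : ℕ} {γ : gspFinAdelic δ}
    (hγ : γ ∈ principalLevelSubgroup δ 1) {J J' : C0pm δ} {a a' : gspFinAdelic δ}
    (h : SiegelShimuraSet.mk δ (principalLevelSubgroup δ N) J a = SiegelShimuraSet.mk δ (principalLevelSubgroup δ N) J' a') :
    SiegelShimuraSet.mk δ (principalLevelSubgroup δ N) J (a * γ) =
      SiegelShimuraSet.mk δ (principalLevelSubgroup δ N) J' (a' * γ) :=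
  SiegelShimuraSet.mk_mul_eq_mk_mul_of_mem_normalizer (principalLevelSubgroup_one_le_normalizer δ N hγ) h

/-- The Hecke translate `T_γ`, `γ ∈ GSp_δ(ℤ̂)`, on `Sh_{K_δ(N)}(GSp_δ, S^±)(ℂ)` exists and is unique.
[cite: Deligne1971TravauxShimura, Déf. 3.1 p. 136 and 4.17 p. 150] [cite: Milne2005ShimuraVarieties, Thm. 13.6 p. 118] -/
theorem SiegelShimuraSet.existsUnique_rightTranslate_principal {N : ℕ} {γ : gspFinAdelic δ}
    (hγ : γ ∈ principalLevelSubgroup δ 1) :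
    ∃! T : SiegelShimuraSet δ (principalLevelSubgroup δ N) → SiegelShimuraSet δ (principalLevelSubgroup δ N),
      ∀ (J : C0pm δ) (a : gspFinAdelic δ),
        T (SiegelShimuraSet.mk δ (principalLevelSubgroup δ N) J a) =
          SiegelShimuraSet.mk δ (principalLevelSubgroup δ N) J (a * γ) :=
  SiegelShimuraSet.existsUnique_rightTranslate (principalLevelSubgroup_one_le_normalizer δ N hγ)

end Principal

/-! ### §3. The `HasIntegralHecke` reading on a Siegel complex record system -/

section RecordSystem

variable {δ : Fin g → ℕ}

/-- **The point equation of `SiegelRationalModel.HasIntegralHecke` is representative-independent.**  For every Siegel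
complex record system `Sg`, level `K : SiegelLevel δ` (`K = K_δ(N)`, `N ≥ 3`) and `γ ∈ K_δ(1)`: if two pairs `(J, a)`,
`(J′, a′)` name the same complex point of `Sg.Mc_K`, then so do `(J, aγ)`, `(J′, a′γ)`.  Hence a map on complex points
prescribed by `(Sg.pts K)⁻¹[J, aK] ↦ (Sg.pts K)⁻¹[J, aγK]` — as `HasIntegralHecke` demands of its `ℚ`-endomorphisms `Tq` — is a
well-posed requirement. [cite: Deligne1971TravauxShimura, Déf. 3.1 p. 136 and 4.17 p. 150] [cite: Milne2005ShimuraVarieties, Thm. 13.6 p. 118] -/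
theorem SiegelComplexRecordSystem.pts_symm_mk_mul_eq_of_pts_symm_mk_eq (Sg : SiegelComplexRecordSystem g δ)
    (K : SiegelLevel δ) {γ : gspFinAdelic δ} (hγ : γ ∈ principalLevelSubgroup δ 1) {J J' : C0pm δ}
    {a a' : gspFinAdelic δ}
    (h : (Sg.pts K).symm (SiegelShimuraSet.mk δ K.1 J a) = (Sg.pts K).symm (SiegelShimuraSet.mk δ K.1 J' a')) :
    (Sg.pts K).symm (SiegelShimuraSet.mk δ K.1 J (a * γ)) = (Sg.pts K).symm (SiegelShimuraSet.mk δ K.1 J' (a' * γ)) := by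
  have hK : (K.1 : Subgroup (gspFinAdelic δ)) = principalLevelSubgroup δ K.N := K.val_eq
  have h' : SiegelShimuraSet.mk δ K.1 J a = SiegelShimuraSet.mk δ K.1 J' a' := (Sg.pts K).symm.injective h
  have hγ' : γ ∈ Subgroup.normalizer ((K.1 : Subgroup (gspFinAdelic δ)) : Set (gspFinAdelic δ)) := by
    rw [hK]; exact principalLevelSubgroup_one_le_normalizer δ K.N hγ
  rw [SiegelShimuraSet.mk_mul_eq_mk_mul_of_mem_normalizer hγ' h']

/-- **Existence and uniqueness of the Hecke translate on the complex points of a level of a Siegel complex record system**: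
for `γ ∈ K_δ(1)` there is exactly one self-map `T` of `Sg.Mc_K(ℂ)` with `T ((Sg.pts K)⁻¹[J, aK]) = (Sg.pts K)⁻¹[J, aγK]`
(transport of §1 along the bijection `Sg.pts K`).  This is the map on complex points that the `ℚ`-endomorphism `Tq` of
`HasIntegralHecke` must induce. [cite: Deligne1971TravauxShimura, Déf. 3.1 p. 136] [cite: Milne2005ShimuraVarieties, Thm. 13.6 p. 118] -/
theorem SiegelComplexRecordSystem.existsUnique_pointTranslate (Sg : SiegelComplexRecordSystem g δ) (K : SiegelLevel δ)
    {γ : gspFinAdelic δ} (hγ : γ ∈ principalLevelSubgroup δ 1) :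
    ∃! T : Motives.ComplexPoints (Sg.Mc.obj K) → Motives.ComplexPoints (Sg.Mc.obj K),
      ∀ (J : C0pm δ) (a : gspFinAdelic δ),
        T ((Sg.pts K).symm (SiegelShimuraSet.mk δ K.1 J a)) = (Sg.pts K).symm (SiegelShimuraSet.mk δ K.1 J (a * γ)) := by
  have hK : (K.1 : Subgroup (gspFinAdelic δ)) = principalLevelSubgroup δ K.N := K.val_eq
  have hγ' : γ ∈ Subgroup.normalizer ((K.1 : Subgroup (gspFinAdelic δ)) : Set (gspFinAdelic δ)) := by
    rw [hK]; exact principalLevelSubgroup_one_le_normalizer δ K.N hγ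
  obtain ⟨T₀, hT₀, hT₀u⟩ := SiegelShimuraSet.existsUnique_rightTranslate (δ := δ) hγ'
  refine ⟨fun P => (Sg.pts K).symm (T₀ (Sg.pts K P)), fun J a => ?_, fun T hT => ?_⟩
  · change (Sg.pts K).symm (T₀ (Sg.pts K ((Sg.pts K).symm _))) = _
    rw [Equiv.apply_symm_apply, hT₀]
  · -- uniqueness: conjugate back along `pts` and use the uniqueness of `T₀`
    have hTc : (fun Q => Sg.pts K (T ((Sg.pts K).symm Q))) = T₀ := by
      refine hT₀u _ fun J a => ?_
      rw [hT J a, Equiv.apply_symm_apply]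
    funext P
    have := congrFun hTc (Sg.pts K P)
    change Sg.pts K (T ((Sg.pts K).symm (Sg.pts K P))) = T₀ (Sg.pts K P) at this
    rw [Equiv.symm_apply_apply] at this
    change T P = (Sg.pts K).symm (T₀ (Sg.pts K P))
    rw [← this, Equiv.symm_apply_apply]

end RecordSystem

end Literature.AlgebraicGeometry.ModuliOfAbelianVarieties

end
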